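import Summits.QuantumAdvantage.QuantumAdvantage.Theorems.CharDialFutureRead
import Summits.QuantumAdvantage.QuantumAdvantage.Theorems.CharDialSchedFibre
import Summits.QuantumAdvantage.QuantumAdvantage.Theorems.CharDialReversal
import HarnessLib
import Summits.QuantumAdvantage.AdviceFreeQNC0.TwoSidedCounters

/-!
# E3ʳ — prefix counters with MEMORY one-reads after the free segment lose (decomp-qadv lens-6 g14, tree part 26)

The memory face of the one-read prefix residual of CharDial's `WalkHardFJLinOdd` (item 32604):
**`prefixPastRead_hard_unif`** — for every prime `p ≠ 3` there are `θ = 5/6` and `m₀ = 6912·p⁵` such that every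
one-read junta ⊕ PREFIX-counter strategy (`JLinData` with `|J g| ≤ 1`, forms `t_g·W_{<g}`) admitting a time `m` with
`m₀` positions `j < m` each read only by cuts `g ≥ m` wins α's u-walk game on at most `θ·2ⁿ` inputs (every `n`, every charge).
Proof: TIME REVERSAL (part 26b: `winCount_rev`, prefix ↦ suffix counters, memory structure at `m` ↦ future structure at
`n − m`) reduces it to **`suffixFutureRead_hard_unif`** (SUFFIX counters `t_g·W_{≥ g}` with future reads promised before
the free segment), which is proved by SLICING on the final counter `W_n ≡ β (p)` — on the slice a suffix form is the prefix
counter statistic `t_g·(β − W_{<g})` (`form_suffix`), so the data are a one-read counter source of part 25 §4 and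
`lose_iff_memT` applies verbatim — and the PER-FIBRE kernel of part 26a (`schedSubcubeFib_sharp`); summing the `p` slices
costs the factor `p` in the error (`m₀ ∝ p⁵`).
WHAT THIS IS NOT: arcs spanning the free segment in BOTH directions simultaneously thin (`OneReadThinHard`, annex §33) stay
OPEN; item 32604 stays OPEN; separation NOT moved.
-/

namespace Summit.QuantumAdvantage.AdviceFreeQNC0

open Finset AffBells22

namespace JLinPeel

open CounterLaw

/-! ## §1 Suffix forms -/

section SuffixForm

variable {p n : ℕ}

/-- a SUFFIX form `t·𝟙[g ≤ i]` evaluates to `t·(wt − W_{<g})`. -/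
theorem form_suffix (D : JLinData p n) {g : Fin (n + 1)} {t : ZMod p}
    (ha : D.a g = fun i => if g.val ≤ i.val then t else 0) (u : Fin n → Bool) :
    D.form g u = t * ((wt u - wtPrefix u g.val : ℕ) : ZMod p) := by
  classical
  unfold JLinData.form
  rw [ha]
  have e : ∀ i : Fin n, (if u i = true then (fun i : Fin n => if g.val ≤ i.val then t else 0) i else 0) =
      if (g.val ≤ i.val ∧ u i = true) then t else 0 := fun i => by
    by_cases h1 : u i = true <;> by_cases h2 : g.val ≤ i.val <;> simp [h1, h2]
  rw [sum_congr rfl fun i _ => e i, ← sum_filter, sum_const, nsmul_eq_mul, mul_comm]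
  congr 1
  have hsplit : (univ.filter fun i : Fin n => g.val ≤ i.val ∧ u i = true).card + wtPrefix u g.val = wt u := by
    unfold wtPrefix wt
    rw [← card_union_of_disjoint]
    · congr 1; ext i
      simp only [mem_union, mem_filter, mem_univ, true_and]
      constructor
      · rintro (⟨_, h⟩ | ⟨_, h⟩) <;> exact h
      · intro h; by_cases hi : g.val ≤ i.val
        · exact Or.inl ⟨hi, h⟩
        · exact Or.inr ⟨by omega, h⟩
    · rw [disjoint_filter]; rintro i _ ⟨h1, _⟩ ⟨h2, _⟩; omega
  have hc : (univ.filter fun i : Fin n => g.val ≤ i.val ∧ u i = true).card = wt u - wtPrefix u g.val := by omega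
  rw [hc]

/-- `str` depends on the statistic only through its value. -/
theorem str_congr_φ {A : Fin (n + 1) → ZMod p → Bool} {B : Fin (n + 1) → Fin n → ZMod p → Bool}
    {rp : Fin (n + 1) → Option (Fin n)} {φ φ' : Fin (n + 1) → (Fin n → Bool) → ZMod p} {g : Fin (n + 1)}
    {v : Fin n → Bool} (h : φ g v = φ' g v) : str A B rp φ g v = str A B rp φ' g v := by
  unfold str; rw [h]

end SuffixForm

/-! ## §2 The generic reduction, per final-counter fibre -/

section GenericFib

variable {p n : ℕ} (A : Fin (n + 1) → ZMod p → Bool) (B : Fin (n + 1) → Fin n → ZMod p → Bool)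
  (rp : Fin (n + 1) → Option (Fin n)) (φ : Fin (n + 1) → (Fin n → Bool) → ZMod p)
  (W : Finset (Fin n)) (b : Fin n → Bool)
  (hφ : ∀ g : Fin (n + 1), ∀ u v : Fin n → Bool, wtPrefix u g.val % p = wtPrefix v g.val % p → φ g u = φ g v)
  (hfut : ∀ g j, rp g = some j → j ∉ W → ∀ i : Fin n, i.val < g.val → i ∈ W)
include hφ hfut

/-- CharDialPastRead helper `win_iff_not_memT` (decomp-qadv land package; see the module docstring). -/
theorem win_iff_not_memT (c : ℕ) (u : Fin n → Bool) :
    ringWinU c (str A B rp φ) (subcubeMerge W b u) = true ↔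
      mem ((((n : ℕ) : ZMod 3) - c), none)
        (XTp p (yC A B rp φ W b) (τF B rp φ W b) (subcubeMerge W b u) n).1
        (XTp p (yC A B rp φ W b) (τF B rp φ W b) (subcubeMerge W b u) n).2.1 = false := by
  have h := lose_iff_memT A B rp φ W b hφ hfut (p := p) c u
  constructor
  · intro hw
    cases hm : mem ((((n : ℕ) : ZMod 3) - c), none)
        (XTp p (yC A B rp φ W b) (τF B rp φ W b) (subcubeMerge W b u) n).1
        (XTp p (yC A B rp φ W b) (τF B rp φ W b) (subcubeMerge W b u) n).2.1
    · rfl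
    · rw [h.2 hm] at hw; exact absurd hw (by simp)
  · intro hm
    cases hw : ringWinU c (str A B rp φ) (subcubeMerge W b u)
    · rw [h.1 hw] at hm; exact absurd hm (by simp)
    · rfl

/-- **the generic bound on a final-counter fibre** (`3 ∤ p`, `0 < p`). -/
theorem winSubcubeFib_le (h3 : ¬ 3 ∣ p) (hp : 0 < p) (c : ℕ) (β : ZMod p) :
    ((univ.filter fun u : Fin n → Bool => ctrN p (subcubeMerge W b u) n = β ∧
        ringWinU c (str A B rp φ) (subcubeMerge W b u) = true).card : ℝ)
      ≤ 2 / 3 * ((univ.filter fun u : Fin n → Bool => ctrN p (subcubeMerge W b u) n = β).card : ℝ)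
        + 4 * p * (2 : ℝ) ^ n * Real.sqrt (12 * p / ((n - W.card : ℕ) + 1)) := by
  have e : (univ.filter fun u : Fin n → Bool => ctrN p (subcubeMerge W b u) n = β ∧
        ringWinU c (str A B rp φ) (subcubeMerge W b u) = true)
      = univ.filter fun u : Fin n → Bool => ctrN p (subcubeMerge W b u) n = β ∧
          mem ((((n : ℕ) : ZMod 3) - c), none)
            (XTp p (yC A B rp φ W b) (τF B rp φ W b) (subcubeMerge W b u) n).1
            (XTp p (yC A B rp φ W b) (τF B rp φ W b) (subcubeMerge W b u) n).2.1 = false := by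
    refine filter_congr fun u _ => ?_
    rw [win_iff_not_memT A B rp φ W b hφ hfut c u]
  rw [e]
  exact schedSubcubeFib_sharp p h3 hp (yC A B rp φ W b) (τF B rp φ W b) W b _ β

end GenericFib

/-! ## §3 Suffix one-read data on a final-counter fibre are one-read counter sources -/

section Suffix

variable {p n : ℕ} (D : JLinData p n)
  (hsuf : ∀ g, ∃ t : ZMod p, D.a g = fun i => if g.val ≤ i.val then t else 0)
  (hJ1 : ∀ g, (D.J g).card ≤ 1)
include hsuf hJ1

/-- **E3 for SUFFIX data on a subcube**: `#WIN ≤ (2/3 + 4p²√(12p/(n − |W| + 1)))·2ⁿ`. -/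
theorem suffixFutureReadSubcube_le (W : Finset (Fin n)) (b : Fin n → Bool) (h3 : ¬ 3 ∣ p) (hp : 0 < p)
    (hfut : ∀ g, ∀ j ∈ D.J g, j ∉ W → ∀ i : Fin n, i.val < g.val → i ∈ W) (c : ℕ) :
    ((univ.filter fun u : Fin n → Bool => ringWinU c D.strat (subcubeMerge W b u) = true).card : ℝ)
      ≤ (2 / 3 + 4 * p ^ 2 * Real.sqrt (12 * p / ((n - W.card : ℕ) + 1))) * (2 : ℝ) ^ n := by
  classical
  haveI : NeZero p := ⟨hp.ne'⟩
  choose t ht using hsuf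
  -- the slice statistic
  set φβ : ZMod p → Fin (n + 1) → (Fin n → Bool) → ZMod p := fun β g v => t g * (β - ctrN p v g.val) with hφβ
  have hφ : ∀ β, ∀ g : Fin (n + 1), ∀ u v : Fin n → Bool,
      wtPrefix u g.val % p = wtPrefix v g.val % p → φβ β g u = φβ β g v := by
    intro β g u v huv
    simp only [hφβ, ctrN, (ZMod.natCast_eq_natCast_iff' _ _ _).2 huv]
  have hfut' : ∀ g j, readPos D g = some j → j ∉ W → ∀ i : Fin n, i.val < g.val → i ∈ W := fun g j hr hj =>
    hfut g j (by rw [junta_of_readPos_some D hJ1 hr]; exact mem_singleton_self j) hj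
  -- on the fibre `W_n ≡ β`, the data play the source `(tabA, tabB, readPos, φβ)`
  have hfib : ∀ (β : ZMod p) (u : Fin n → Bool), ctrN p (subcubeMerge W b u) n = β →
      ringWinU c D.strat (subcubeMerge W b u) = ringWinU c (str (tabA D) (tabB D) (readPos D) (φβ β)) (subcubeMerge W b u) := by
    intro β u hβ
    refine Summit.QuantumAdvantage.AdviceFreeQNC0.LinForms.ringWinU_congr c fun g => ?_
    rw [strat_eq_str D hJ1]
    refine str_congr_φ ?_
    rw [form_suffix D (ht g)]
    simp only [hφβ]
    rw [← hβ]
    unfold ctrN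
    rw [ConstBells.wtPrefix_self, Nat.cast_sub (Summit.QuantumAdvantage.AdviceFreeQNC0.CounterLaw.wtPrefix_le_wt _ _)]
  -- fibrewise count
  have hcount : ((univ.filter fun u : Fin n → Bool => ringWinU c D.strat (subcubeMerge W b u) = true).card : ℝ)
      = ∑ β : ZMod p, ((univ.filter fun u : Fin n → Bool => ctrN p (subcubeMerge W b u) n = β ∧
          ringWinU c (str (tabA D) (tabB D) (readPos D) (φβ β)) (subcubeMerge W b u) = true).card : ℝ) := by
    rw [card_eq_sum_card_fiberwise (t := (univ : Finset (ZMod p)))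
      (f := fun u : Fin n → Bool => ctrN p (subcubeMerge W b u) n) (fun u _ => mem_univ _), Nat.cast_sum]
    refine sum_congr rfl fun β _ => ?_
    congr 2
    ext u
    simp only [mem_filter, mem_univ, true_and]
    constructor
    · rintro ⟨hw, hβ⟩; exact ⟨hβ, by rw [← hfib β u hβ]; exact hw⟩
    · rintro ⟨hβ, hw⟩; exact ⟨by rw [hfib β u hβ]; exact hw, hβ⟩
  have htot : ∑ β : ZMod p, ((univ.filter fun u : Fin n → Bool => ctrN p (subcubeMerge W b u) n = β).card : ℝ)
      = (2 : ℝ) ^ n := by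
    rw [← Nat.cast_sum, ← card_eq_sum_card_fiberwise (s := (univ : Finset (Fin n → Bool)))
      (t := (univ : Finset (ZMod p))) (f := fun u : Fin n → Bool => ctrN p (subcubeMerge W b u) n)
      (fun u _ => mem_univ _)]
    simp
  rw [hcount]
  calc _ ≤ ∑ β : ZMod p, (2 / 3 * ((univ.filter fun u : Fin n → Bool => ctrN p (subcubeMerge W b u) n = β).card : ℝ)
        + 4 * p * (2 : ℝ) ^ n * Real.sqrt (12 * p / ((n - W.card : ℕ) + 1))) :=
        sum_le_sum fun β _ => winSubcubeFib_le (tabA D) (tabB D) (readPos D) (φβ β) W b (hφ β) hfut' h3 hp c β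
    _ = (2 / 3 + 4 * p ^ 2 * Real.sqrt (12 * p / ((n - W.card : ℕ) + 1))) * (2 : ℝ) ^ n := by
        rw [sum_add_distrib, ← mul_sum, htot, sum_const, card_univ, ZMod.card, nsmul_eq_mul]; ring

end Suffix

/-! ## §4 The theorems -/

section Main

variable {p : ℕ} [hp : Fact p.Prime]

/-- **E3 for SUFFIX counters, explicit constants** (prime `p ≠ 3`; every `n`, every charge): one-read junta ⊕
suffix-counter strategies with `6912·p⁵` future-read positions promised before the free segment win on `≤ (5/6)·2ⁿ` inputs. -/
theorem suffixFutureRead_hard_explicit (hp3 : p ≠ 3) (n c : ℕ) (D : JLinData p n)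
    (hsuf : ∀ g, ∃ t : ZMod p, D.a g = fun i => if g.val ≤ i.val then t else 0)
    (hJ1 : ∀ g, (D.J g).card ≤ 1)
    (hF : ∃ m : ℕ, 6912 * p ^ 5 ≤ (univ.filter fun j : Fin n => m ≤ j.val ∧ ∀ g, j ∈ D.J g → g.val ≤ m).card) :
    (winCount c D.strat : ℝ) ≤ 5 / 6 * (2 : ℝ) ^ n := by
  classical
  have h3 : ¬ 3 ∣ p := fun h => hp3 ((Nat.prime_dvd_prime_iff_eq Nat.prime_three hp.out).mp h).symm
  have hp0 : 0 < p := hp.out.pos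
  obtain ⟨m, hm⟩ := hF
  set F : Finset (Fin n) := univ.filter fun j : Fin n => m ≤ j.val ∧ ∀ g, j ∈ D.J g → g.val ≤ m with hFdef
  set W : Finset (Fin n) := univ.filter fun j : Fin n => ¬ (m ≤ j.val ∧ ∀ g, j ∈ D.J g → g.val ≤ m) with hW
  have hFW : F.card + W.card = n := by
    have := Finset.card_filter_add_card_filter_not (s := (univ : Finset (Fin n)))
      (fun j : Fin n => m ≤ j.val ∧ ∀ g, j ∈ D.J g → g.val ≤ m)
    simpa [hFdef, hW] using this
  have hnW : n - W.card = F.card := by omega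
  have hfut : ∀ g, ∀ j ∈ D.J g, j ∉ W → ∀ i : Fin n, i.val < g.val → i ∈ W := by
    intro g j hj hjW i hi
    have hjF : m ≤ j.val ∧ ∀ g, j ∈ D.J g → g.val ≤ m := by
      by_contra hc; exact hjW (mem_filter.2 ⟨mem_univ _, hc⟩)
    have hgm : g.val ≤ m := hjF.2 g hj
    exact mem_filter.2 ⟨mem_univ _, fun h => by omega⟩
  have hb : ∀ b : Fin n → Bool,
      ((univ.filter fun u : Fin n → Bool => ringWinU c D.strat (subcubeMerge W b u) = true).card : ℝ)
        ≤ 5 / 6 * (2 : ℝ) ^ n := by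
    intro b
    refine (suffixFutureReadSubcube_le D hsuf hJ1 W b h3 hp0 hfut c).trans
      (mul_le_mul_of_nonneg_right ?_ (by positivity))
    rw [hnW]
    have hp1 : (1 : ℝ) ≤ p := by exact_mod_cast hp0
    have hn' : (6912 : ℝ) * p ^ 5 ≤ (F.card : ℝ) + 1 := by
      have : ((6912 * p ^ 5 : ℕ) : ℝ) ≤ (F.card : ℝ) := by exact_mod_cast hm
      push_cast at this; linarith
    have hpos : (0 : ℝ) < (F.card : ℝ) + 1 := by positivity
    have hfrac : (12 : ℝ) * p / ((F.card : ℝ) + 1) ≤ (1 / (24 * p ^ 2)) ^ 2 := by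
      rw [div_le_iff₀ hpos]
      have e : (1 / (24 * (p : ℝ) ^ 2)) ^ 2 * (6912 * p ^ 5) = 12 * p := by field_simp; ring
      calc (12 : ℝ) * p = (1 / (24 * (p : ℝ) ^ 2)) ^ 2 * (6912 * p ^ 5) := e.symm
        _ ≤ (1 / (24 * (p : ℝ) ^ 2)) ^ 2 * ((F.card : ℝ) + 1) := by
            apply mul_le_mul_of_nonneg_left hn'; positivity
    have hsq : Real.sqrt (12 * p / ((F.card : ℝ) + 1)) ≤ 1 / (24 * p ^ 2) := by
      calc Real.sqrt (12 * p / ((F.card : ℝ) + 1)) ≤ Real.sqrt ((1 / (24 * p ^ 2)) ^ 2) := Real.sqrt_le_sqrt hfrac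
        _ = 1 / (24 * p ^ 2) := Real.sqrt_sq (by positivity)
    have : 4 * (p : ℝ) ^ 2 * Real.sqrt (12 * p / ((F.card : ℝ) + 1)) ≤ 4 * p ^ 2 * (1 / (24 * p ^ 2)) :=
      mul_le_mul_of_nonneg_left hsq (by positivity)
    have h16 : 4 * (p : ℝ) ^ 2 * (1 / (24 * p ^ 2)) = 1 / 6 := by field_simp; ring
    linarith
  have hsum := sum_card_subcube W (fun u : Fin n → Bool => ringWinU c D.strat u = true)
  have h2n : (0 : ℝ) < 2 ^ n := by positivity
  have hR : (2 : ℝ) ^ n * (winCount c D.strat : ℝ) ≤ (2 : ℝ) ^ n * (5 / 6 * 2 ^ n) := by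
    have e1 : (2 : ℝ) ^ n * (winCount c D.strat : ℝ) =
        ∑ b : Fin n → Bool,
          ((univ.filter fun u : Fin n → Bool => ringWinU c D.strat (subcubeMerge W b u) = true).card : ℝ) := by
      unfold winCount; rw [← Nat.cast_sum, hsum]; push_cast; ring
    rw [e1]
    calc _ ≤ ∑ b : Fin n → Bool, 5 / 6 * (2 : ℝ) ^ n := sum_le_sum fun b _ => hb b
      _ = (2 : ℝ) ^ n * (5 / 6 * 2 ^ n) := by
          rw [sum_const, card_univ, Fintype.card_fun, Fintype.card_bool, Fintype.card_fin]; simp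
  exact le_of_mul_le_mul_left hR h2n


/-- **E3 for SUFFIX counters** (prime `p ≠ 3`; `θ = 5/6`, `m₀ = 6912·p⁵`; every `n`, every charge). -/
theorem suffixFutureRead_hard_unif (hp3 : p ≠ 3) :
    ∃ θ : ℝ, θ < 1 ∧ ∃ m₀ : ℕ, ∀ (n c : ℕ) (D : JLinData p n),
      (∀ g, ∃ t : ZMod p, D.a g = fun i => if g.val ≤ i.val then t else 0) →
      (∀ g, (D.J g).card ≤ 1) →
      (∃ m : ℕ, m₀ ≤ (univ.filter fun j : Fin n => m ≤ j.val ∧ ∀ g, j ∈ D.J g → g.val ≤ m).card) →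
      (winCount c D.strat : ℝ) ≤ θ * (2 : ℝ) ^ n :=
  ⟨5 / 6, by norm_num, 6912 * p ^ 5, fun n c D hsuf hJ1 hF => suffixFutureRead_hard_explicit hp3 n c D hsuf hJ1 hF⟩

/-- **E3ʳ, explicit constants** (prime `p ≠ 3`; every `n`, every charge): a one-read junta ⊕ PREFIX-counter strategy
with a time `m` and `6912·p⁵` positions `j < m` each read only by cuts `g ≥ m` wins on at most `(5/6)·2ⁿ` inputs. -/
theorem prefixPastRead_hard_explicit (hp3 : p ≠ 3) (n c : ℕ) (D : JLinData p n)
    (hpre : ∀ g, ∃ t : ZMod p, D.a g = fun i => if i.val < g.val then t else 0)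
    (hJ1 : ∀ g, (D.J g).card ≤ 1)
    (hF : ∃ m : ℕ, 6912 * p ^ 5 ≤ (univ.filter fun j : Fin n => j.val < m ∧ ∀ g, j ∈ D.J g → m ≤ g.val).card) :
    (winCount c D.strat : ℝ) ≤ 5 / 6 * (2 : ℝ) ^ n := by
  classical
  obtain ⟨m, hm⟩ := hF
  -- clip `m` to `n`
  set m' := min m n with hm'
  have hm'n : m' ≤ n := min_le_right _ _
  have hmono : (univ.filter fun j : Fin n => j.val < m ∧ ∀ g, j ∈ D.J g → m ≤ g.val)
      ⊆ univ.filter fun j : Fin n => j.val < m' ∧ ∀ g, j ∈ D.J g → m' ≤ g.val := by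
    intro j hj
    simp only [mem_filter, mem_univ, true_and] at hj ⊢
    have := j.isLt
    refine ⟨by omega, fun g hg => ?_⟩
    have := hj.2 g hg
    omega
  have hm₀ : 6912 * p ^ 5
      ≤ (univ.filter fun j : Fin n => n - m' ≤ j.val ∧ ∀ g, j ∈ D.rev.J g → g.val ≤ n - m').card := by
    rw [← card_pastFree_eq D hm'n]
    exact hm.trans (card_le_card hmono)
  have h := suffixFutureRead_hard_explicit (p := p) hp3 n (2 * c + 2 * n) D.rev (rev_suffix_of_prefix D hpre)
    (card_J_rev_le D hJ1) ⟨n - m', hm₀⟩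
  rwa [winCount_rev] at h

/-- **E3ʳ — prefix counters with MEMORY one-reads after the free segment lose** (prime `p ≠ 3`; `θ = 5/6`,
`m₀ = 6912·p⁵`; every `n`, every charge). -/
theorem prefixPastRead_hard_unif (hp3 : p ≠ 3) :
    ∃ θ : ℝ, θ < 1 ∧ ∃ m₀ : ℕ, ∀ (n c : ℕ) (D : JLinData p n),
      (∀ g, ∃ t : ZMod p, D.a g = fun i => if i.val < g.val then t else 0) →
      (∀ g, (D.J g).card ≤ 1) →
      (∃ m : ℕ, m₀ ≤ (univ.filter fun j : Fin n => j.val < m ∧ ∀ g, j ∈ D.J g → m ≤ g.val).card) →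
      (winCount c D.strat : ℝ) ≤ θ * (2 : ℝ) ^ n :=
  ⟨5 / 6, by norm_num, 6912 * p ^ 5, fun n c D hpre hJ1 hF => prefixPastRead_hard_explicit hp3 n c D hpre hJ1 hF⟩

end Main

end JLinPeel

end Summit.QuantumAdvantage.AdviceFreeQNC0
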